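import Summits.Ventures.QEC.Census.CertCheck
import HarnessLib

/-!
# Distance certificate DATA for the LP code `LP36w5` (CERT-FORMAT v1 → `DistCert`), emitted by qec-search-7

Source certificate: `cert/search-4/j262728/LPb_3x3_l6_b0-1_E0-0-0.0-2-4.0-4-2.certA.json` — kernel A, id (sha256) `371103695c3e0abc3ed758ca5d0a040204025995bd61669653d559dcb1a304af`
(`certA=371103695c3e0abc` on HOME/STATUS.md), lower-bound methods bruteforce (Z) / bruteforce (X), `found` allow-lists of
sizes 18 (Z) / 18 (X). Code: n = 36, 18 X-checks, 18 Z-checks;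
construction "explicit".
Claimed result (by the certificate; established ONLY by the checker theorems in the sibling files):
n = 36, k = 4, dZ = 6, dX = 6, d = 6. Printed parameters (none printed: census-discovered code, search-4 third-method claim only) are a CLAIM of
census/search-4 CLAIM line (third method, not a source in print) — never an input.

Conventions (= `Summits/Ventures/QEC/Census/CertCheck.lean`): a row / operator support is the binary numeral with bit `j` set iff
qubit `j` is in the support; side `Z` = Z-type operators (syndromes by `HX`, stabilizers `HZ`), side `X` the roles exchanged;
`found` = (word, indices of stabilizer rows XOR-ing to it). This file is DATA: no theorem, no `decide`. Generated
2026-08-27T01:08Z by `HOME/census/search-7/emit_lean.py` (rerun recipe in its README); do not edit by hand — re-emit.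
-/

namespace Summit.Ventures.QEC.Census.LP36w5


/-- The distance certificate of `LP36w5` as a `DistCert` literal (CERT-FORMAT v1 kernel fields; certificate id
`371103695c3e0abc`): `n = 36`, `HX`/`HZ` = the 18 + 18 check rows as bitmasks, side Z = (d := 6, weight-6 Z-logical
witness, its non-membership witness, allow-list), side X likewise (d := 6). -/
def cert : DistCert where
  n := 36
  HX := [
    8654913, 794754, 1589508, 3179016, 6358032, 12716064,
    553665537, 50366466, 100728900, 201457800, 402657552, 805315104,
    35433545985, 3221357058, 6442456068, 12884912136, 25769820240, 51539640480]
  HZ := [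
    1090781187, 2181562374, 4363124748, 8726249496, 17452498992, 34904997921,
    17247240384, 34494480768, 1343226624, 2686453248, 4315941888, 8631879744,
    4563677184, 9127354368, 17197744128, 34395488256, 1145241600, 2290225152]
  sideZ := { d := 6, witness := 1365, nonmember := 1090619903,
             found := [
      (1090781187, [0]), (34904997921, [5]),
      (2181562374, [1]), (4363124748, [2]),
      (8726249496, [3]), (17452498992, [4]),
      (17247240384, [6]), (8631879744, [0, 1, 2, 3, 4, 5, 6, 7, 8, 9, 10]),
      (34494480768, [7]), (1343226624, [8]),
      (2686453248, [9]), (4315941888, [10]),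
      (4563677184, [12]), (2290225152, [0, 1, 2, 3, 4, 5, 12, 13, 14, 15, 16]),
      (9127354368, [13]), (17197744128, [14]),
      (34395488256, [15]), (1145241600, [16])] }
  sideX := { d := 6, witness := 17449615366, nonmember := 1365,
             found := [
      (8654913, [0]), (35433545985, [12]),
      (553665537, [6]), (794754, [1]),
      (3221357058, [13]), (50366466, [7]),
      (100728900, [8]), (1589508, [2]),
      (6442456068, [14]), (201457800, [9]),
      (3179016, [3]), (12884912136, [15]),
      (25769820240, [16]), (402657552, [10]),
      (6358032, [4]), (51539640480, [0, 1, 2, 3, 4, 5, 12, 13, 14, 15, 16]),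
      (805315104, [0, 1, 2, 3, 4, 5, 6, 7, 8, 9, 10]), (12716064, [5])] }

end Summit.Ventures.QEC.Census.LP36w5
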